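import Summits.Ventures.Crystal3D.Theorems.StickyWulffConstantNoReconstructionGainOffLattice
import HarnessLib

/-!
# L3′ for a moved lattice: a point off a rigid image of `Λ₀` touches at most three of its sites

HONEST FRAMING. Part of the venture `Summits/Ventures/Crystal3D` (cell `crystal3d-full`), helper
`--supports` the crux `NoReconstructionGain` (stmt-Ventures-19144, route
`route-Ventures-StickyWulffConstant`); also the form planner cf-p1 g16 asked for on the WALL branch
(stmt-Ventures-19480/19481: «off-lattice ≤ 3 w.r.t. a moved lattice»).  Isometry-invariance
bookkeeping around `fcc_offLattice_unitContacts_le_three` (`…OffLattice`, p520278):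

`fcc_offLattice_unitContacts_le_three_moved` — for every linear isometry `A` and translation `t`,
a point `q ∉ A(Λ₀) + t` is at distance exactly `1` from at most three points of `A(Λ₀) + t`.

WHAT THIS IS NOT: anything about walls or grain boundaries themselves; rung F-C1 not moved.
-/

noncomputable section

namespace Summit.Ventures.Crystal3D.Theorems

open Summit.Ventures.Crystal3D Finset
open Literature.MathematicalPhysics.StatisticalMechanics (fccStacking)

/-- **L3′ for a rigid image of `Λ₀`.**  If `q ∉ (fun p => A p + t) '' Λ₀` for a linear isometry
`A` of `ℝ³` and a translation `t`, then at most three points of that image are at distance `1`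
from `q`. -/
theorem fcc_offLattice_unitContacts_le_three_moved
    (A : EuclideanSpace ℝ (Fin 3) ≃ₗᵢ[ℝ] EuclideanSpace ℝ (Fin 3)) (t : EuclideanSpace ℝ (Fin 3))
    (q : EuclideanSpace ℝ (Fin 3))
    (hq : q ∉ (fun p => A p + t) '' fccStacking 1 (Real.sqrt (2 / 3)))
    (S : Finset (EuclideanSpace ℝ (Fin 3)))
    (hS : ∀ y ∈ S, y ∈ (fun p => A p + t) '' fccStacking 1 (Real.sqrt (2 / 3)) ∧ dist q y = 1) :
    S.card ≤ 3 := by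
  classical
  -- pull back by the inverse rigid motion `y ↦ A.symm (y − t)`
  set g : EuclideanSpace ℝ (Fin 3) → EuclideanSpace ℝ (Fin 3) := fun y => A.symm (y - t) with hg
  have hginj : Function.Injective g := by
    intro y y' h
    simp only [hg] at h
    have := A.symm.injective h
    exact sub_left_injective this
  have hgA : ∀ p, g (A p + t) = p := fun p => by simp [hg]
  have hdist : ∀ y y', dist (g y) (g y') = dist y y' := fun y y' => by
    simp only [hg]
    rw [LinearIsometryEquiv.dist_map, dist_sub_right]
  have hq' : g q ∉ fccStacking 1 (Real.sqrt (2 / 3)) := by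
    intro h
    apply hq
    refine ⟨g q, h, ?_⟩
    simp [hg]
  have hS' : ∀ y ∈ S.image g, y ∈ fccStacking 1 (Real.sqrt (2 / 3)) ∧ dist (g q) y = 1 := by
    intro y hy
    obtain ⟨z, hz, rfl⟩ := mem_image.1 hy
    obtain ⟨⟨p, hp, hpz⟩, hd⟩ := hS z hz
    refine ⟨?_, by rw [hdist, hd]⟩
    rw [← hpz, hgA]; exact hp
  have h := fcc_offLattice_unitContacts_le_three (g q) hq' (S.image g) hS'
  rwa [card_image_of_injective _ hginj] at h

end Summit.Ventures.Crystal3D.Theorems
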